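import Mathlib
import HarnessLib
import Literature.MathematicalPhysics.QuantumFieldTheory.ConstructiveQFTWave0
import Summits.Ventures.LatticeQCDFlow.Exactness.FlowPushforward
import Summits.Ventures.LatticeQCDFlow.Scaling.EntropyBudgetMeasure

/-!
# LatticeQCDFlow / Scaling — the entropy budget of an exact flow, IV: flow form (`log M + log K`)

HONEST FRAMING: exact (Metropolis-corrected) sampling algorithms for lattice gauge theory;
figures of merit are autocorrelation/cost numbers at stated couplings and volumes; no
continuum-physics claim.

Venture `LatticeQCDFlow` (cell pub-lqcd), topic `Scaling`, THEORY-2.md §3.2 (h) / §4 row T2-AG(m)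
(theory seat GEN-10).  Part III (`Scaling/EntropyBudgetMeasure.lean`) proved
`ESS(μ, g·η) ≤ C·exp(−D(μ ‖ η))` for a model of sup-density `C` against the reference `η`.  This
file is the DICTIONARY TO FLOWS, as a theorem: a flow is a measurable bijection `F : Ω ≃ᵐ Ω` with an
exact Jacobian `J` in the sense of `Exactness.HasJacobian η F J` (`F_*(J·η) = η`, the venture's
exactness vocabulary, `Exactness/FlowPushforward.lean`), pushing a prior `r·η` to the model
`F_*(r·η) = ((r/J) ∘ F⁻¹)·η` (`HasJacobian.map_withDensity_equiv`).  Hence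

* `flowModel_eq_withDensity` — the flow's model IS a density model, with density
  `g = (r/J) ∘ F⁻¹` against `η`;
* `essM_flow_le` — **`ESS(μ, F_*(r·η)) ≤ M·K·exp(−D(μ ‖ η))`** for a prior density `0 < r ≤ M` and
  a volume CONTRACTION bound `1/J ≤ K` (i.e. `J ≥ 1/K`: the flow may shrink reference volume by at
  most the factor `K` anywhere) — the measure form of the finite `essFrac_pushLaw_le`
  (`Scaling/EntropyBudget.lean`): `log M + log K ≥ D(μ ‖ η) − log(1/ESS)`;
* `Lattice.wilson_essM_flow_le` / `wilson_essM_flow_le_rpow` — the same on `GaugeConfig d L G`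
  against product Haar for the Wilson measure of any continuous `ρ` (`Re tr ρ ≤ N`, `β ≥ 0`), and
  with an entropy growth lower bound `s·log β − c·L^d ≤ D`: `ESS ≤ M·K·e^{cL^d}·β^{−s}`.

For a composition of layers the contraction bounds multiply (`HasJacobian.comp`: Jacobians
multiply along the flow), so `log K ≤ Σ_layers log K_layer ≤ (depth) × (links touched per layer) ×
(per-link log-contraction clamp)` for the coupling architectures in use — the CAPACITY that
THEORY-2.md §3.2 (h) compares with `(κ/2)(d−1)L^d·log β`.  References as in Part III; Albergo,
Kanwar, Shanahan, Phys. Rev. D 100 (2019) 034515 = arXiv:1904.12072 §II (flow reweighting);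
Kanwar et al. arXiv:2003.06413; Boyda et al. arXiv:2008.05456 (gauge-equivariant layers).
-/

namespace Summit.Ventures.LatticeQCDFlow.Theory2

open MeasureTheory InformationTheory Summit.Ventures.LatticeQCDFlow.Exactness
open scoped ENNReal

variable {Ω : Type*} [MeasurableSpace Ω]

/-- **The flow's model is a density model.**  For a flow `F` with exact Jacobian `J = ofReal ∘ j`,
`j > 0`, w.r.t. `η` and a real prior density `r`, `F_*(r·η) = ((r/j) ∘ F⁻¹)·η`. [folklore] -/
theorem flowModel_eq_withDensity (η : Measure Ω) {F : Ω ≃ᵐ Ω} {j : Ω → ℝ}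
    (hF : HasJacobian η F fun z => ENNReal.ofReal (j z)) (hj0 : ∀ z, 0 < j z)
    {r : Ω → ℝ} (hr : Measurable r) :
    Measure.map F (η.withDensity fun z => ENNReal.ofReal (r z)) =
      η.withDensity fun x => ENNReal.ofReal (r (F.symm x) / j (F.symm x)) := by
  rw [hF.map_withDensity_equiv (fun z => (ENNReal.ofReal_pos.mpr (hj0 z)).ne')
    (fun z => ENNReal.ofReal_ne_top) hr.ennreal_ofReal]
  refine withDensity_congr_ae (Filter.Eventually.of_forall fun x => ?_)
  exact (ENNReal.ofReal_div_of_pos (hj0 _)).symm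

/-- **T2-AG, flow form (`log M + log K` budget).**  Probability measures `μ ≪ η` with
`llr μ η ∈ L¹(μ)`; a flow `F : Ω ≃ᵐ Ω` with exact Jacobian `ofReal ∘ j` w.r.t. `η`, volume
contraction bounded by `K` (`1/j ≤ K`); a prior `r·η` with measurable `0 < r ≤ M`.  Then the exact
sampler that proposes from the flow's model `F_*(r·η)` has `ESS ≤ M·K·exp(−D(μ ‖ η))`. [folklore] -/
theorem essM_flow_le (η μ : Measure Ω) [IsProbabilityMeasure η] [IsProbabilityMeasure μ]
    (hμη : μ ≪ η) (hllr : Integrable (llr μ η) μ) {F : Ω ≃ᵐ Ω} {j : Ω → ℝ}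
    (hF : HasJacobian η F fun z => ENNReal.ofReal (j z)) (hj : Measurable j) (hj0 : ∀ z, 0 < j z)
    {K : ℝ} (hjK : ∀ z, (j z)⁻¹ ≤ K) {r : Ω → ℝ} (hr : Measurable r) (hr0 : ∀ z, 0 < r z) {M : ℝ}
    (hrM : ∀ z, r z ≤ M) :
    essM μ (Measure.map F (η.withDensity fun z => ENNReal.ofReal (r z))) ≤
      M * K * Real.exp (-(klDiv μ η).toReal) := by
  rw [flowModel_eq_withDensity η hF hj0 hr]
  have hg : Measurable fun x => r (F.symm x) / j (F.symm x) :=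
    (hr.comp F.symm.measurable).div (hj.comp F.symm.measurable)
  refine essM_le_mul_exp_neg_klDiv η μ hμη hllr hg (fun x => div_pos (hr0 _) (hj0 _)) fun x => ?_
  rw [div_eq_mul_inv]
  exact mul_le_mul (hrM (F.symm x)) (hjK (F.symm x)) (inv_nonneg.mpr (hj0 (F.symm x)).le)
    ((hr0 (F.symm x)).le.trans (hrM (F.symm x)))

end Summit.Ventures.LatticeQCDFlow.Theory2

/-! ## On the lattice: flows of gauge configurations against product Haar -/

namespace Summit.Ventures.LatticeQCDFlow.Theory2.Lattice

open MeasureTheory InformationTheory Summit.Ventures.LatticeQCDFlow.Exactness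
open Literature.MathematicalPhysics.QuantumFieldTheory
open scoped ENNReal

variable {N : ℕ} {G : Type*} [Group G] [TopologicalSpace G] [IsTopologicalGroup G]
  [CompactSpace G] [SecondCountableTopology G] [MeasurableSpace G] [BorelSpace G]
  (ρ : G →* Matrix (Fin N) (Fin N) ℂ)

/-- **The `log M + log K` budget of an exact flow sampler of lattice gauge theory.**  For `β ≥ 0`,
a continuous `ρ` with `Re tr ρ ≤ N`, a flow `F` of `GaugeConfig d L G` with exact Jacobian
`ofReal ∘ j` w.r.t. product Haar and contraction bound `1/j ≤ K`, and a prior of density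
`0 < r ≤ M` w.r.t. product Haar: `ESS ≤ M·K·exp(−D(μ_{Λ,β} ‖ Haar^{⊗E}))`. [folklore] -/
theorem wilson_essM_flow_le {d L : ℕ} [NeZero L]
    (hρ : Continuous (ρ : G → Matrix (Fin N) (Fin N) ℂ)) (htr : ∀ g, (ρ g).trace.re ≤ N)
    {β : ℝ} (hβ : 0 ≤ β) {F : GaugeConfig d L G ≃ᵐ GaugeConfig d L G}
    {j : GaugeConfig d L G → ℝ}
    (hF : HasJacobian (Measure.pi fun _ : Edge d L => haarProbability G) F
      fun V => ENNReal.ofReal (j V))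
    (hj : Measurable j) (hj0 : ∀ V, 0 < j V) {K : ℝ} (hjK : ∀ V, (j V)⁻¹ ≤ K)
    {r : GaugeConfig d L G → ℝ} (hr : Measurable r) (hr0 : ∀ V, 0 < r V) {M : ℝ}
    (hrM : ∀ V, r V ≤ M) :
    essM (wilsonMeasure (d := d) (L := L) ρ β)
        (Measure.map F ((Measure.pi fun _ : Edge d L => haarProbability G).withDensity
          fun V => ENNReal.ofReal (r V))) ≤
      M * K * Real.exp (-(klDiv (wilsonMeasure (d := d) (L := L) ρ β)
        (Measure.pi fun _ : Edge d L => haarProbability G)).toReal) := by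
  obtain ⟨hμ, hac, hllr⟩ := wilsonMeasure_ac_integrable_llr (d := d) (L := L) ρ hρ htr hβ
  exact essM_flow_le _ _ hac hllr hF hj hj0 hjK hr hr0 hrM

/-- The flow form of the volume × coupling law: an entropy growth lower bound
`s·log β − c·L^d ≤ D(μ_{Λ,β} ‖ Haar^{⊗E})` (`β ≥ 1`) gives `ESS ≤ M·K·e^{cL^d}·β^{−s}` for every
exact flow sampler with prior density `≤ M` and volume contraction `≤ K`. [folklore] -/
theorem wilson_essM_flow_le_rpow {d L : ℕ} [NeZero L]
    (hρ : Continuous (ρ : G → Matrix (Fin N) (Fin N) ℂ)) (htr : ∀ g, (ρ g).trace.re ≤ N)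
    {β s c : ℝ} (hβ : 1 ≤ β)
    (hD : s * Real.log β - c * (L : ℝ) ^ d ≤ (klDiv (wilsonMeasure (d := d) (L := L) ρ β)
        (Measure.pi fun _ : Edge d L => haarProbability G)).toReal)
    {F : GaugeConfig d L G ≃ᵐ GaugeConfig d L G} {j : GaugeConfig d L G → ℝ}
    (hF : HasJacobian (Measure.pi fun _ : Edge d L => haarProbability G) F
      fun V => ENNReal.ofReal (j V))
    (hj : Measurable j) (hj0 : ∀ V, 0 < j V) {K : ℝ} (hjK : ∀ V, (j V)⁻¹ ≤ K)
    {r : GaugeConfig d L G → ℝ} (hr : Measurable r) (hr0 : ∀ V, 0 < r V) {M : ℝ}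
    (hrM : ∀ V, r V ≤ M) :
    essM (wilsonMeasure (d := d) (L := L) ρ β)
        (Measure.map F ((Measure.pi fun _ : Edge d L => haarProbability G).withDensity
          fun V => ENNReal.ofReal (r V))) ≤
      M * K * Real.exp (c * (L : ℝ) ^ d) * β ^ (-s) := by
  have hβ0 : 0 < β := one_pos.trans_le hβ
  have hM : 0 < M := (hr0 fun _ => 1).trans_le (hrM fun _ => 1)
  have hK : 0 < K := (inv_pos.mpr (hj0 fun _ => 1)).trans_le (hjK fun _ => 1)
  refine (wilson_essM_flow_le (d := d) (L := L) ρ hρ htr hβ0.le hF hj hj0 hjK hr hr0 hrM).trans ?_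
  rw [mul_assoc (M * K)]
  refine mul_le_mul_of_nonneg_left ?_ (mul_pos hM hK).le
  rw [Real.rpow_def_of_pos hβ0, ← Real.exp_add]
  exact Real.exp_le_exp.mpr (by linarith)

end Summit.Ventures.LatticeQCDFlow.Theory2.Lattice
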